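import Mathlib
import Summits.Ventures.PercRepro2.CoinKSureLayer
import Summits.Ventures.PercRepro2.CoinKSureAD
import Summits.Ventures.PercRepro2.CoinKSureFibers
import Summits.Ventures.PercRepro2.CoinKSureGate

/-!
# The clean-state theorem with a BOTTOM BOUND in place of `G' = G` off the entries
(blind cell PercRepro2, night-2 g16; proofs/NIGHT2-DARC.md §56.16)

In the tree's `gate_functional_nonneg` the hypothesis `hI` («the gate equals the `R`-law on the
entry-free clusters») is used only to derive the two BOTTOM BOUNDS — the gate's state means of `x`
and `y` on the entry-free state are at most the global `R`-means (`ideal_mean`).  This file proves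
the same conclusion from those two bounds directly (`gate_functional_nonneg_of_bottom`); the
original theorem is its corollary (`gate_functional_nonneg'`).  For the CHAINED OR-VERTEX of §56
with the entry set `ent` (the entries of `a` inside the core), every hypothesis of the clean-state
theorem holds for the κ-integrated pair `(ν·chainMix ρ c d, ν·chainMix ρ c d')` EXCEPT `hI`
(the two laws are different mixtures on the clusters that meet `ent'` only): so the chain is
within exactly the two bottom bounds of the existing machinery — `chain_functional_nonneg_of_bottom`
in `CoinChainBottom.lean`.
-/

namespace Summit.Ventures.PercRepro2.Coin

open Classical

section GateBottom

variable {V : Type*} [DecidableEq V] {R : Type*} [Field R] [LinearOrder R] [IsStrictOrderedRing R]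

/-- **THE CLEAN-STATE THEOREM WITH A BOTTOM BOUND IN PLACE OF THE EQUALITY OFF THE ENTRIES.**
`G` (the `R`-law) and `G'` (the gate) log-supermodular on `U.powerset`, the gate Holley-above
the `R`-law from every cluster containing an entry of `ent` (`wML`); instead of `G' = G` on the
entry-free clusters only the two BOTTOM BOUNDS are assumed: the gate's means of `x` and of `y` on
the entry-free clusters are at most the global `R`-means (`hbx`, `hby`, cleared form).  `x, y`
nonnegative increasing markers.  Then `Λ²M₁₁ − ΛΛ₁M₂ − ΛΛ₂M₁ + Λ₁Λ₂M ≥ 0`.  The proof is the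
tree's `gate_functional_nonneg` word for word, the two bottom bounds replacing `ideal_mean`. -/
theorem gate_functional_nonneg_of_bottom (U ent : Finset V) (G G' x y : Finset V → R)
    (hG : ∀ W, 0 ≤ G W) (hG' : ∀ W, 0 ≤ G' W)
    (hx0 : ∀ W, 0 ≤ x W) (hy0 : ∀ W, 0 ≤ y W)
    (hxm : ∀ s t, x s ≤ x (s ∪ t)) (hym : ∀ s t, y s ≤ y (s ∪ t))
    (wMM : ∀ s ⊆ U, ∀ t ⊆ U, G' s * G' t ≤ G' (s ∩ t) * G' (s ∪ t))
    (wML : ∀ s ⊆ U, ∀ t ⊆ U, (∃ r ∈ ent, r ∈ s) → G' s * G t ≤ G (s ∩ t) * G' (s ∪ t))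
    (hbx : (∑ W ∈ U.powerset.filter (fun W => W ∩ ent = ∅), G' W * x W) * (∑ W ∈ U.powerset, G W) ≤
      (∑ W ∈ U.powerset.filter (fun W => W ∩ ent = ∅), G' W) * (∑ W ∈ U.powerset, G W * x W))
    (hby : (∑ W ∈ U.powerset.filter (fun W => W ∩ ent = ∅), G' W * y W) * (∑ W ∈ U.powerset, G W) ≤
      (∑ W ∈ U.powerset.filter (fun W => W ∩ ent = ∅), G' W) * (∑ W ∈ U.powerset, G W * y W)) :
    0 ≤ (∑ W ∈ U.powerset, G W) ^ 2 * (∑ W ∈ U.powerset, G' W * (x W * y W))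
        - (∑ W ∈ U.powerset, G W) * (∑ W ∈ U.powerset, G W * x W) *
          (∑ W ∈ U.powerset, G' W * y W)
        - (∑ W ∈ U.powerset, G W) * (∑ W ∈ U.powerset, G W * y W) *
          (∑ W ∈ U.powerset, G' W * x W)
        + (∑ W ∈ U.powerset, G W * x W) * (∑ W ∈ U.powerset, G W * y W) *
          (∑ W ∈ U.powerset, G' W) := by
  -- the `R`-law totals
  set Λ := ∑ W ∈ U.powerset, G W with hΛ
  set Λ₁ := ∑ W ∈ U.powerset, G W * x W with hΛ₁
  set Λ₂ := ∑ W ∈ U.powerset, G W * y W with hΛ₂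
  have hΛ0 : 0 ≤ Λ := Finset.sum_nonneg fun W _ => hG W
  have hΛ₁0 : 0 ≤ Λ₁ := Finset.sum_nonneg fun W _ => mul_nonneg (hG W) (hx0 W)
  have hΛ₂0 : 0 ≤ Λ₂ := Finset.sum_nonneg fun W _ => mul_nonneg (hG W) (hy0 W)
  clear_value Λ Λ₁ Λ₂
  -- state masses and state means of the gate
  set N : Finset V → R := fun e => ∑ W ∈ U.powerset.filter (fun W => W ∩ ent = e), G' W with hN
  set Nx : Finset V → R :=
    fun e => ∑ W ∈ U.powerset.filter (fun W => W ∩ ent = e), G' W * x W with hNx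
  set Ny : Finset V → R :=
    fun e => ∑ W ∈ U.powerset.filter (fun W => W ∩ ent = e), G' W * y W with hNy
  have hN0 : ∀ e, 0 ≤ N e := fun e => Finset.sum_nonneg fun W _ => hG' W
  have hNx0 : ∀ e, 0 ≤ Nx e := fun e => Finset.sum_nonneg fun W _ => mul_nonneg (hG' W) (hx0 W)
  have hNy0 : ∀ e, 0 ≤ Ny e := fun e => Finset.sum_nonneg fun W _ => mul_nonneg (hG' W) (hy0 W)
  set Xb : Finset V → R := fun W => Nx (W ∩ ent) / N (W ∩ ent) with hXb
  set Yb : Finset V → R := fun W => Ny (W ∩ ent) / N (W ∩ ent) with hYb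
  have hXb0 : ∀ W, 0 ≤ Xb W := fun W => div_nonneg (hNx0 _) (hN0 _)
  have hYb0 : ∀ W, 0 ≤ Yb W := fun W => div_nonneg (hNy0 _) (hN0 _)
  -- the state mass of a cluster in the support is positive
  have hNpos : ∀ s ⊆ U, G' s ≠ 0 → 0 < N (s ∩ ent) := by
    intro s hs hs0
    have h1 : 0 < G' s := lt_of_le_of_ne (hG' s) (Ne.symm hs0)
    have h2 : G' s ≤ N (s ∩ ent) :=
      Finset.single_le_sum (f := G') (fun W _ => hG' W)
        (Finset.mem_filter.mpr ⟨Finset.mem_powerset.mpr hs, rfl⟩)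
    exact lt_of_lt_of_le h1 h2
  -- joins stay in the support
  have hjoin : ∀ s ⊆ U, ∀ t ⊆ U, G' s ≠ 0 → G' t ≠ 0 → G' (s ∪ t) ≠ 0 := by
    intro s hs t ht hs0 ht0 hu
    have h1 : 0 < G' s * G' t :=
      mul_pos (lt_of_le_of_ne (hG' s) (Ne.symm hs0)) (lt_of_le_of_ne (hG' t) (Ne.symm ht0))
    have h2 := wMM s hs t ht
    rw [hu, mul_zero] at h2
    exact absurd (lt_of_lt_of_le h1 h2) (lt_irrefl 0)
  have hjoin' : ∀ s ⊆ U, ∀ t ⊆ U, (∃ r ∈ ent, r ∈ s) → G' s ≠ 0 → G t ≠ 0 →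
      G' (s ∪ t) ≠ 0 := by
    intro s hs t ht hent hs0 ht0 hu
    have h1 : 0 < G' s * G t :=
      mul_pos (lt_of_le_of_ne (hG' s) (Ne.symm hs0)) (lt_of_le_of_ne (hG t) (Ne.symm ht0))
    have h2 := wML s hs t ht hent
    rw [hu, mul_zero] at h2
    exact absurd (lt_of_lt_of_le h1 h2) (lt_irrefl 0)
  -- the state means are increasing on the support
  have hXb_mono : ∀ s ⊆ U, ∀ t ⊆ U, G' s ≠ 0 → G' (s ∪ t) ≠ 0 → Xb s ≤ Xb (s ∪ t) := by
    intro s hs t ht hs0 hu0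
    have hee : s ∩ ent ⊆ (s ∪ t) ∩ ent :=
      Finset.inter_subset_inter Finset.subset_union_left (Finset.Subset.refl _)
    have hNs := hNpos s hs hs0
    have hNu := hNpos (s ∪ t) (Finset.union_subset hs ht) hu0
    have key : Nx (s ∩ ent) * N ((s ∪ t) ∩ ent) ≤ N (s ∩ ent) * Nx ((s ∪ t) ∩ ent) :=
      fiber_holley U ent (s ∩ ent) ((s ∪ t) ∩ ent) G' x hG' hx0 hxm wMM hee
    show Nx (s ∩ ent) / N (s ∩ ent) ≤ Nx ((s ∪ t) ∩ ent) / N ((s ∪ t) ∩ ent)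
    rw [div_le_div_iff₀ hNs hNu]
    linarith [key]
  have hYb_mono : ∀ s ⊆ U, ∀ t ⊆ U, G' s ≠ 0 → G' (s ∪ t) ≠ 0 → Yb s ≤ Yb (s ∪ t) := by
    intro s hs t ht hs0 hu0
    have hee : s ∩ ent ⊆ (s ∪ t) ∩ ent :=
      Finset.inter_subset_inter Finset.subset_union_left (Finset.Subset.refl _)
    have hNs := hNpos s hs hs0
    have hNu := hNpos (s ∪ t) (Finset.union_subset hs ht) hu0
    have key : Ny (s ∩ ent) * N ((s ∪ t) ∩ ent) ≤ N (s ∩ ent) * Ny ((s ∪ t) ∩ ent) :=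
      fiber_holley U ent (s ∩ ent) ((s ∪ t) ∩ ent) G' y hG' hy0 hym wMM hee
    show Ny (s ∩ ent) / N (s ∩ ent) ≤ Ny ((s ∪ t) ∩ ent) / N ((s ∪ t) ∩ ent)
    rw [div_le_div_iff₀ hNs hNu]
    linarith [key]
  -- the ideal state: its gate means are below the global `R`-means (the bottom bounds)
  have hu₀ : Λ * (Nx ∅ / N ∅) - Λ₁ ≤ 0 := by
    by_cases h : N ∅ = 0
    · rw [h, div_zero, mul_zero]; linarith
    · have hpos : 0 < N ∅ := lt_of_le_of_ne (hN0 ∅) (Ne.symm h)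
      have key : Nx ∅ * Λ ≤ N ∅ * Λ₁ := by
        simp only [hNx, hN]; exact hbx
      have : Λ * (Nx ∅ / N ∅) ≤ Λ₁ := by
        rw [mul_div_assoc', div_le_iff₀ hpos]; linarith [key]
      linarith
  have hw₀ : Λ * (Ny ∅ / N ∅) - Λ₂ ≤ 0 := by
    by_cases h : N ∅ = 0
    · rw [h, div_zero, mul_zero]; linarith
    · have hpos : 0 < N ∅ := lt_of_le_of_ne (hN0 ∅) (Ne.symm h)
      have key : Ny ∅ * Λ ≤ N ∅ * Λ₂ := by
        simp only [hNy, hN]; exact hby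
      have : Λ * (Ny ∅ / N ∅) ≤ Λ₂ := by
        rw [mul_div_assoc', div_le_iff₀ hpos]; linarith [key]
      linarith
  -- every state mean on the support is above the ideal state mean
  have hu : ∀ W ∈ U.powerset, G' W ≠ 0 → Λ * (Nx ∅ / N ∅) - Λ₁ ≤ Λ * Xb W - Λ₁ := by
    intro W hW hW0
    have hWU : W ⊆ U := Finset.mem_powerset.mp hW
    have hle : Nx ∅ / N ∅ ≤ Xb W := by
      by_cases h : N ∅ = 0
      · rw [h, div_zero]; exact hXb0 W
      · have hpos : 0 < N ∅ := lt_of_le_of_ne (hN0 ∅) (Ne.symm h)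
        have hNW := hNpos W hWU hW0
        have key : Nx ∅ * N (W ∩ ent) ≤ N ∅ * Nx (W ∩ ent) :=
          fiber_holley U ent ∅ (W ∩ ent) G' x hG' hx0 hxm wMM (Finset.empty_subset _)
        show Nx ∅ / N ∅ ≤ Nx (W ∩ ent) / N (W ∩ ent)
        rw [div_le_div_iff₀ hpos hNW]
        linarith [key]
    have := mul_le_mul_of_nonneg_left hle hΛ0
    linarith
  have hw : ∀ W ∈ U.powerset, G' W ≠ 0 → Λ * (Ny ∅ / N ∅) - Λ₂ ≤ Λ * Yb W - Λ₂ := by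
    intro W hW hW0
    have hWU : W ⊆ U := Finset.mem_powerset.mp hW
    have hle : Ny ∅ / N ∅ ≤ Yb W := by
      by_cases h : N ∅ = 0
      · rw [h, div_zero]; exact hYb0 W
      · have hpos : 0 < N ∅ := lt_of_le_of_ne (hN0 ∅) (Ne.symm h)
        have hNW := hNpos W hWU hW0
        have key : Ny ∅ * N (W ∩ ent) ≤ N ∅ * Ny (W ∩ ent) :=
          fiber_holley U ent ∅ (W ∩ ent) G' y hG' hy0 hym wMM (Finset.empty_subset _)
        show Ny ∅ / N ∅ ≤ Ny (W ∩ ent) / N (W ∩ ent)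
        rw [div_le_div_iff₀ hpos hNW]
        linarith [key]
    have := mul_le_mul_of_nonneg_left hle hΛ0
    linarith
  -- the level sets of the `y`-shift: Holley-above the `R`-law
  have hlevw : ∀ t, Λ * (Ny ∅ / N ∅) - Λ₂ < t →
      0 ≤ ∑ W ∈ U.powerset.filter (fun W => t ≤ Λ * Yb W - Λ₂), G' W * (Λ * Xb W - Λ₁) := by
    intro t ht
    have hP : ∀ s ⊆ U, ∀ t' ⊆ U, t ≤ Λ * Yb s - Λ₂ → G' s ≠ 0 → G t' ≠ 0 →
        t ≤ Λ * Yb (s ∪ t') - Λ₂ ∧ (∃ r ∈ ent, r ∈ s) := by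
      intro s hs t' ht' hPs hs0 ht'0
      have hent : ∃ r ∈ ent, r ∈ s := by
        by_contra hno
        have hse : s ∩ ent = ∅ := by
          rw [Finset.eq_empty_iff_forall_notMem]
          intro r hr
          rw [Finset.mem_inter] at hr
          exact hno ⟨r, hr.2, hr.1⟩
        have hYs : Yb s = Ny ∅ / N ∅ := by
          show Ny (s ∩ ent) / N (s ∩ ent) = Ny ∅ / N ∅
          rw [hse]
        rw [hYs] at hPs
        linarith
      refine ⟨?_, hent⟩
      have hu0 := hjoin' s hs t' ht' hent hs0 ht'0
      have hmono := hYb_mono s hs t' ht' hs0 hu0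
      have := mul_le_mul_of_nonneg_left hmono hΛ0
      linarith
    have key := level_holley U ent G G' x hG hG' hx0 hxm wML (fun W => t ≤ Λ * Yb W - Λ₂) hP
    rw [← hΛ, ← hΛ₁] at key
    have hmean : (∑ W ∈ U.powerset.filter (fun W => t ≤ Λ * Yb W - Λ₂), G' W * Xb W) =
        ∑ W ∈ U.powerset.filter (fun W => t ≤ Λ * Yb W - Λ₂), G' W * x W :=
      sum_fiber_mean U ent G' x hG' (fun e => t ≤ Λ * (Ny e / N e) - Λ₂)
    have hexp : (∑ W ∈ U.powerset.filter (fun W => t ≤ Λ * Yb W - Λ₂), G' W * (Λ * Xb W - Λ₁)) =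
        Λ * (∑ W ∈ U.powerset.filter (fun W => t ≤ Λ * Yb W - Λ₂), G' W * Xb W) -
          Λ₁ * (∑ W ∈ U.powerset.filter (fun W => t ≤ Λ * Yb W - Λ₂), G' W) := by
      rw [Finset.mul_sum, Finset.mul_sum, ← Finset.sum_sub_distrib]
      exact Finset.sum_congr rfl fun W _ => by ring
    rw [hexp, hmean]
    linarith [key]
  -- the level sets of the `x`-shift: Holley-above the `R`-law
  have hlevu : ∀ t, Λ * (Nx ∅ / N ∅) - Λ₁ < t →
      0 ≤ ∑ W ∈ U.powerset.filter (fun W => t ≤ Λ * Xb W - Λ₁), G' W * (Λ * Yb W - Λ₂) := by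
    intro t ht
    have hP : ∀ s ⊆ U, ∀ t' ⊆ U, t ≤ Λ * Xb s - Λ₁ → G' s ≠ 0 → G t' ≠ 0 →
        t ≤ Λ * Xb (s ∪ t') - Λ₁ ∧ (∃ r ∈ ent, r ∈ s) := by
      intro s hs t' ht' hPs hs0 ht'0
      have hent : ∃ r ∈ ent, r ∈ s := by
        by_contra hno
        have hse : s ∩ ent = ∅ := by
          rw [Finset.eq_empty_iff_forall_notMem]
          intro r hr
          rw [Finset.mem_inter] at hr
          exact hno ⟨r, hr.2, hr.1⟩
        have hXs : Xb s = Nx ∅ / N ∅ := by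
          show Nx (s ∩ ent) / N (s ∩ ent) = Nx ∅ / N ∅
          rw [hse]
        rw [hXs] at hPs
        linarith
      refine ⟨?_, hent⟩
      have hu0 := hjoin' s hs t' ht' hent hs0 ht'0
      have hmono := hXb_mono s hs t' ht' hs0 hu0
      have := mul_le_mul_of_nonneg_left hmono hΛ0
      linarith
    have key := level_holley U ent G G' y hG hG' hy0 hym wML (fun W => t ≤ Λ * Xb W - Λ₁) hP
    rw [← hΛ, ← hΛ₂] at key
    have hmean : (∑ W ∈ U.powerset.filter (fun W => t ≤ Λ * Xb W - Λ₁), G' W * Yb W) =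
        ∑ W ∈ U.powerset.filter (fun W => t ≤ Λ * Xb W - Λ₁), G' W * y W :=
      sum_fiber_mean U ent G' y hG' (fun e => t ≤ Λ * (Nx e / N e) - Λ₁)
    have hexp : (∑ W ∈ U.powerset.filter (fun W => t ≤ Λ * Xb W - Λ₁), G' W * (Λ * Yb W - Λ₂)) =
        Λ * (∑ W ∈ U.powerset.filter (fun W => t ≤ Λ * Xb W - Λ₁), G' W * Yb W) -
          Λ₂ * (∑ W ∈ U.powerset.filter (fun W => t ≤ Λ * Xb W - Λ₁), G' W) := by
      rw [Finset.mul_sum, Finset.mul_sum, ← Finset.sum_sub_distrib]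
      exact Finset.sum_congr rfl fun W _ => by ring
    rw [hexp, hmean]
    linarith [key]
  -- FKG for the gate with the increasing state means
  have hF : (∑ W ∈ U.powerset, G' W * Xb W) * (∑ W ∈ U.powerset, G' W * Yb W) ≤
      (∑ W ∈ U.powerset, G' W) * (∑ W ∈ U.powerset, G' W * (Xb W * Yb W)) := by
    have n₁ : ∀ W, 0 ≤ G' W * Xb W := fun W => mul_nonneg (hG' W) (hXb0 W)
    have n₂ : ∀ W, 0 ≤ G' W * Yb W := fun W => mul_nonneg (hG' W) (hYb0 W)
    have n₃ : ∀ W, 0 ≤ G' W := hG'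
    have n₄ : ∀ W, 0 ≤ G' W * (Xb W * Yb W) :=
      fun W => mul_nonneg (hG' W) (mul_nonneg (hXb0 W) (hYb0 W))
    refine ad_pointwise U _ _ _ _ n₁ n₂ n₃ n₄ ?_
    intro s hs t ht
    by_cases hs0 : G' s = 0
    · rw [hs0, zero_mul, zero_mul]; exact mul_nonneg (n₃ _) (n₄ _)
    · by_cases ht0 : G' t = 0
      · rw [ht0, zero_mul, mul_zero]; exact mul_nonneg (n₃ _) (n₄ _)
      · have hu0 := hjoin s hs t ht hs0 ht0
        have hxs := hXb_mono s hs t ht hs0 hu0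
        have hu0' : G' (t ∪ s) ≠ 0 := by rw [Finset.union_comm]; exact hu0
        have hyt : Yb t ≤ Yb (s ∪ t) := by
          rw [Finset.union_comm]; exact hYb_mono t ht s hs ht0 hu0'
        calc G' s * Xb s * (G' t * Yb t) = (G' s * G' t) * (Xb s * Yb t) := by ring
          _ ≤ (G' (s ∩ t) * G' (s ∪ t)) * (Xb (s ∪ t) * Yb (s ∪ t)) :=
              mul_le_mul (wMM s hs t ht) (mul_le_mul hxs hyt (hYb0 t) (hXb0 _))
                (mul_nonneg (hXb0 s) (hYb0 t)) (mul_nonneg (hG' _) (hG' _))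
          _ = G' (s ∩ t) * (G' (s ∪ t) * (Xb (s ∪ t) * Yb (s ∪ t))) := by ring
  have e1 : (∑ W ∈ U.powerset, G' W * (Λ * Xb W - Λ₁)) =
      Λ * (∑ W ∈ U.powerset, G' W * Xb W) - Λ₁ * (∑ W ∈ U.powerset, G' W) := by
    rw [Finset.mul_sum, Finset.mul_sum, ← Finset.sum_sub_distrib]
    exact Finset.sum_congr rfl fun W _ => by ring
  have e2 : (∑ W ∈ U.powerset, G' W * (Λ * Yb W - Λ₂)) =
      Λ * (∑ W ∈ U.powerset, G' W * Yb W) - Λ₂ * (∑ W ∈ U.powerset, G' W) := by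
    rw [Finset.mul_sum, Finset.mul_sum, ← Finset.sum_sub_distrib]
    exact Finset.sum_congr rfl fun W _ => by ring
  have e3 : (∑ W ∈ U.powerset, G' W * (Λ * Xb W - Λ₁) * (Λ * Yb W - Λ₂)) =
      Λ * Λ * (∑ W ∈ U.powerset, G' W * (Xb W * Yb W))
        - Λ * Λ₂ * (∑ W ∈ U.powerset, G' W * Xb W)
        - Λ * Λ₁ * (∑ W ∈ U.powerset, G' W * Yb W)
        + Λ₁ * Λ₂ * (∑ W ∈ U.powerset, G' W) := by
    rw [Finset.mul_sum, Finset.mul_sum, Finset.mul_sum, Finset.mul_sum,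
      ← Finset.sum_sub_distrib, ← Finset.sum_sub_distrib, ← Finset.sum_add_distrib]
    exact Finset.sum_congr rfl fun W _ => by ring
  have hfkg : (∑ W ∈ U.powerset, G' W * (Λ * Xb W - Λ₁)) *
      (∑ W ∈ U.powerset, G' W * (Λ * Yb W - Λ₂)) ≤
      (∑ W ∈ U.powerset, G' W) *
        ∑ W ∈ U.powerset, G' W * (Λ * Xb W - Λ₁) * (Λ * Yb W - Λ₂) := by
    rw [e1, e2, e3]
    have key := mul_le_mul_of_nonneg_left hF (mul_nonneg hΛ0 hΛ0)
    linarith [key]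
  -- the clean state lemma
  have hT2 : 0 ≤ ∑ W ∈ U.powerset, G' W * (Λ * Xb W - Λ₁) * (Λ * Yb W - Λ₂) :=
    csl_main U.powerset G' (fun W => Λ * Xb W - Λ₁) (fun W => Λ * Yb W - Λ₂)
      (fun W _ => hG' W) (Λ * (Nx ∅ / N ∅) - Λ₁) (Λ * (Ny ∅ / N ∅) - Λ₂) hu₀ hw₀ hu hw hfkg
      hlevw hlevu
  -- within-state FKG and the fibre identities
  have hprod : (∑ W ∈ U.powerset, G' W * (Xb W * Yb W)) ≤
      ∑ W ∈ U.powerset, G' W * (x W * y W) :=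
    sum_fiber_prod_le U ent G' x y hG' hx0 hy0 hxm hym wMM
  have hmx : (∑ W ∈ U.powerset, G' W * Xb W) = ∑ W ∈ U.powerset, G' W * x W :=
    sum_mean_eq U ent G' x hG'
  have hmy : (∑ W ∈ U.powerset, G' W * Yb W) = ∑ W ∈ U.powerset, G' W * y W :=
    sum_mean_eq U ent G' y hG'
  rw [e3, hmx, hmy] at hT2
  have hprod' := mul_le_mul_of_nonneg_left hprod (mul_nonneg hΛ0 hΛ0)
  have hsq : Λ ^ 2 = Λ * Λ := sq Λ
  rw [hsq]
  linarith [hT2, hprod']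


/-- The tree's theorem as a corollary: `hI` gives the bottom bounds by `ideal_mean`. -/
theorem gate_functional_nonneg' (U ent : Finset V) (G G' x y : Finset V → R)
    (hG : ∀ W, 0 ≤ G W) (hG' : ∀ W, 0 ≤ G' W)
    (hx0 : ∀ W, 0 ≤ x W) (hy0 : ∀ W, 0 ≤ y W)
    (hxm : ∀ s t, x s ≤ x (s ∪ t)) (hym : ∀ s t, y s ≤ y (s ∪ t))
    (wLL : ∀ s ⊆ U, ∀ t ⊆ U, G s * G t ≤ G (s ∩ t) * G (s ∪ t))
    (wMM : ∀ s ⊆ U, ∀ t ⊆ U, G' s * G' t ≤ G' (s ∩ t) * G' (s ∪ t))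
    (wML : ∀ s ⊆ U, ∀ t ⊆ U, (∃ r ∈ ent, r ∈ s) → G' s * G t ≤ G (s ∩ t) * G' (s ∪ t))
    (hI : ∀ W, W ∩ ent = ∅ → G' W = G W) :
    0 ≤ (∑ W ∈ U.powerset, G W) ^ 2 * (∑ W ∈ U.powerset, G' W * (x W * y W))
        - (∑ W ∈ U.powerset, G W) * (∑ W ∈ U.powerset, G W * x W) *
          (∑ W ∈ U.powerset, G' W * y W)
        - (∑ W ∈ U.powerset, G W) * (∑ W ∈ U.powerset, G W * y W) *
          (∑ W ∈ U.powerset, G' W * x W)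
        + (∑ W ∈ U.powerset, G W * x W) * (∑ W ∈ U.powerset, G W * y W) *
          (∑ W ∈ U.powerset, G' W) := by
  have hG'I : ∀ W ∈ U.powerset.filter (fun W => W ∩ ent = ∅), G' W = G W :=
    fun W hW => hI W (Finset.mem_filter.mp hW).2
  have e0 : ∑ W ∈ U.powerset.filter (fun W => W ∩ ent = ∅), G' W =
      ∑ W ∈ U.powerset.filter (fun W => W ∩ ent = ∅), G W :=
    Finset.sum_congr rfl fun W hW => hG'I W hW
  have ex : ∑ W ∈ U.powerset.filter (fun W => W ∩ ent = ∅), G' W * x W =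
      ∑ W ∈ U.powerset.filter (fun W => W ∩ ent = ∅), G W * x W :=
    Finset.sum_congr rfl fun W hW => by rw [hG'I W hW]
  have ey : ∑ W ∈ U.powerset.filter (fun W => W ∩ ent = ∅), G' W * y W =
      ∑ W ∈ U.powerset.filter (fun W => W ∩ ent = ∅), G W * y W :=
    Finset.sum_congr rfl fun W hW => by rw [hG'I W hW]
  refine gate_functional_nonneg_of_bottom U ent G G' x y hG hG' hx0 hy0 hxm hym wMM wML ?_ ?_
  · rw [ex, e0]; exact ideal_mean U ent G x hG hx0 hxm wLL
  · rw [ey, e0]; exact ideal_mean U ent G y hG hy0 hym wLL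

end GateBottom

end Summit.Ventures.PercRepro2.Coin
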